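import Literature.Computability.Cryptography.RegevSamplerClassical
import Literature.Computability.Complexity.CodeFPStringKit
import HarnessLib

/-!
# The suffixes of the Regev sampler's classical blocks, on codes

Topic `Computability/Cryptography`, a small brick for the uniformity of the machine sampler of [Regev2009, Lemma 3.14]:
the three classical blocks `circY`, `circS`, `circX` are clean XOR blocks (`CleanXor.circuit`) whose constant suffixes
`vY Λ`, `vS Λ`, `vX Λ` (`= CleanBlockInput.suffix (code of the block parameters) (data length)`) enter their abstract
gate lists (`CleanXorAbstract.lean`, `CleanXorDesc.lean`). Here they are computed on codes, in the typed
polynomial-time-on-codes currency `CodeFP`, from a context computing the layout parameters in unary: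

* `suffix_eq`, `suffix_codeFP`, `suffix_codeFP_of` — `CleanBlockInput.suffix w m = w ++ 0 :: 1^{m+1}` on codes;
* `dataLen_codeFP_of` — the tableau data length `n₀ + |v|` in unary;
* `qYE_codeFP_of`, `qXE_codeFP_of` — the parameter codes as strings;
* **`vY_codeFP_of`, `vS_codeFP_of`, `vX_codeFP_of`** and the unary lengths `NY_codeFP_of`, `NS_codeFP_of`, `NX_codeFP_of`.

Everything is proved; no named fact is introduced.

## References

* O. Regev, *On lattices, learning with errors, random linear codes, and cryptography*, J. ACM 56(6) (2009), Lemma 3.14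
  [Regev2009].
* S. Arora, B. Barak, *Computational Complexity: A Modern Approach*, CUP 2009, §6.2 Def. 6.12 / Remark 6.7
  [AroraBarak2009].
-/

noncomputable section

namespace Literature.Computability.Cryptography.Regev2009.SamplerClassical

open _root_.Computability Complexity Complexity.CodeFP QuantumComplexity SamplerWordFns

/-! ### The suffix on codes -/

/-- The suffix with the unary numeral spelled out. [folklore] -/
theorem suffix_eq (w : List Bool) (m : ℕ) : CleanBlockInput.suffix w m = w ++ false :: unE (m + 1) := by
  rw [CleanBlockInput.suffix, unE_eq_ones]

/-- **`CleanBlockInput.suffix` on codes** (input: the parameter string and the data length in unary).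
[cite: AroraBarak2009, §6.2 Remark 6.7] -/
theorem suffix_codeFP : CodeFP (pairE strE unE) strE (fun p => CleanBlockInput.suffix p.1 p.2) :=
  (strAppend.comp ((fst _ _).pair (consBit.comp ((const _ false).pair (strOfUn.comp (unSucc.comp (snd _ _))))))).congr
    fun p => (suffix_eq p.1 p.2).symm

/-- Context-generic form. [folklore] -/
theorem suffix_codeFP_of {σ : Type} {eσ : σ → List Bool} {w : σ → List Bool} {m : σ → ℕ} (hw : CodeFP eσ strE w)
    (hm : CodeFP eσ unE m) : CodeFP eσ strE (fun c => CleanBlockInput.suffix (w c) (m c)) :=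
  (suffix_codeFP.comp (hw.pair hm) :)

/-- The tableau data length `n₀ + |v|` in unary. [folklore] -/
theorem dataLen_codeFP_of {σ : Type} {eσ : σ → List Bool} {n₀ : σ → ℕ} {v : σ → List Bool} (hn₀ : CodeFP eσ unE n₀)
    (hv : CodeFP eσ strE v) : CodeFP eσ unE (fun c => n₀ c + (v c).length) :=
  (unAdd.comp (hn₀.pair (strLength.comp hv)) :)

/-! ### The parameter codes as strings -/

/-- The code `qYE` of a quadruple of unary parameters, as a string. [folklore] -/
theorem qYE_codeFP_of {σ : Type} {eσ : σ → List Bool} {a b c d : σ → ℕ} (ha : CodeFP eσ unE a) (hb : CodeFP eσ unE b)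
    (hc : CodeFP eσ unE c) (hd : CodeFP eσ unE d) : CodeFP eσ strE (fun s => qYE (a s, (b s, (c s, d s)))) := by
  have hq : CodeFP qYE strE (fun q => qYE q) := recode fun _ => rfl
  exact (hq.comp (ha.pair (hb.pair (hc.pair hd))) :)

/-- The code `qXE` of a sextuple of unary parameters, as a string. [folklore] -/
theorem qXE_codeFP_of {σ : Type} {eσ : σ → List Bool} {a b c d e f : σ → ℕ} (ha : CodeFP eσ unE a) (hb : CodeFP eσ unE b)
    (hc : CodeFP eσ unE c) (hd : CodeFP eσ unE d) (he : CodeFP eσ unE e) (hf : CodeFP eσ unE f) :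
    CodeFP eσ strE (fun s => qXE (a s, (b s, (c s, (d s, (e s, f s)))))) := by
  have hq : CodeFP qXE strE (fun q => qXE q) := recode fun _ => rfl
  exact (hq.comp (ha.pair (hb.pair (hc.pair (hd.pair (he.pair hf))))) :)

/-! ### The three suffixes -/

variable {σ : Type} {eσ : σ → List Bool} {W n : σ → ℕ} (Λ : (c : σ) → Layout (W c) (n c))

/-- **The branch block's suffix `vY` on codes.** [cite: Regev2009, Lemma 3.14 (proof)] [cite: AroraBarak2009, §6.2] -/
theorem vY_codeFP_of (hn : CodeFP eσ unE n) (hℓ : CodeFP eσ unE (fun c => (Λ c).ℓ)) (hℓY : CodeFP eσ unE (fun c => (Λ c).ℓY))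
    (hLq : CodeFP eσ unE (fun c => (Λ c).Lq)) (hd : CodeFP eσ unE (fun c => n c * (Λ c).ℓ + (Λ c).L)) :
    CodeFP eσ strE (fun c => vY (Λ c)) :=
  (suffix_codeFP_of (qYE_codeFP_of hn hℓ hℓY hLq) hd :)

/-- **The residue block's suffix `vS` on codes.** [cite: Regev2009, Lemma 3.14 (proof)] [cite: AroraBarak2009, §6.2] -/
theorem vS_codeFP_of (hn : CodeFP eσ unE n) (hℓ : CodeFP eσ unE (fun c => (Λ c).ℓ)) (hℓR : CodeFP eσ unE (fun c => (Λ c).ℓR))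
    (hLq : CodeFP eσ unE (fun c => (Λ c).Lq)) (hd : CodeFP eσ unE (fun c => n c * (Λ c).ℓ + (Λ c).L)) :
    CodeFP eσ strE (fun c => vS (Λ c)) :=
  (suffix_codeFP_of (qYE_codeFP_of hn hℓ hℓR hLq) hd :)

/-- **The erasing block's suffix `vX` on codes.** [cite: Regev2009, Lemma 3.14 (proof)] [cite: AroraBarak2009, §6.2] -/
theorem vX_codeFP_of (hn : CodeFP eσ unE n) (hℓ : CodeFP eσ unE (fun c => (Λ c).ℓ)) (hℓY : CodeFP eσ unE (fun c => (Λ c).ℓY))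
    (hℓR : CodeFP eσ unE (fun c => (Λ c).ℓR)) (hbc : CodeFP eσ unE (fun c => (Λ c).bc))
    (hLq : CodeFP eσ unE (fun c => (Λ c).Lq)) (hdX : CodeFP eσ unE (fun c => (Λ c).regLen + (Λ c).L)) :
    CodeFP eσ strE (fun c => vX (Λ c)) :=
  (suffix_codeFP_of (qXE_codeFP_of hn hℓ hℓY hℓR hbc hLq) hdX :)

/-- The branch / residue blocks' tableau data length in unary. [folklore] -/
theorem NY_codeFP_of (hn : CodeFP eσ unE n) (hℓ : CodeFP eσ unE (fun c => (Λ c).ℓ)) (hℓY : CodeFP eσ unE (fun c => (Λ c).ℓY))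
    (hLq : CodeFP eσ unE (fun c => (Λ c).Lq)) (hd : CodeFP eσ unE (fun c => n c * (Λ c).ℓ + (Λ c).L)) :
    CodeFP eσ unE (fun c => (n c * (Λ c).ℓ + (Λ c).L) + (vY (Λ c)).length) :=
  dataLen_codeFP_of hd (vY_codeFP_of Λ hn hℓ hℓY hLq hd)

/-- The residue block's tableau data length in unary. [folklore] -/
theorem NS_codeFP_of (hn : CodeFP eσ unE n) (hℓ : CodeFP eσ unE (fun c => (Λ c).ℓ)) (hℓR : CodeFP eσ unE (fun c => (Λ c).ℓR))
    (hLq : CodeFP eσ unE (fun c => (Λ c).Lq)) (hd : CodeFP eσ unE (fun c => n c * (Λ c).ℓ + (Λ c).L)) :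
    CodeFP eσ unE (fun c => (n c * (Λ c).ℓ + (Λ c).L) + (vS (Λ c)).length) :=
  dataLen_codeFP_of hd (vS_codeFP_of Λ hn hℓ hℓR hLq hd)

/-- The erasing block's tableau data length in unary. [folklore] -/
theorem NX_codeFP_of (hn : CodeFP eσ unE n) (hℓ : CodeFP eσ unE (fun c => (Λ c).ℓ)) (hℓY : CodeFP eσ unE (fun c => (Λ c).ℓY))
    (hℓR : CodeFP eσ unE (fun c => (Λ c).ℓR)) (hbc : CodeFP eσ unE (fun c => (Λ c).bc))
    (hLq : CodeFP eσ unE (fun c => (Λ c).Lq)) (hdX : CodeFP eσ unE (fun c => (Λ c).regLen + (Λ c).L)) :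
    CodeFP eσ unE (fun c => ((Λ c).regLen + (Λ c).L) + (vX (Λ c)).length) :=
  dataLen_codeFP_of hdX (vX_codeFP_of Λ hn hℓ hℓY hℓR hbc hLq hdX)

end Literature.Computability.Cryptography.Regev2009.SamplerClassical

end
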